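import Summits.QuantumFields.BalabanUV.Beta.VariantCutoffRoadExplicit
import Summits.QuantumFields.BalabanUV.Beta.VariantCutoffRoadWitness
import Summits.QuantumFields.BalabanUV.Beta.RemainderExplicitEndWitness

/-!
# Beta / VariantCutoffRoadExplicitWitness — roads P3 ⊕ P2″: NON-VACUITY of the END with (E), (V) discharged and no
# (hr), RELATIVE TO THE EXPLICIT CARRIER FAMILY — every hypothesis of `VariantCutoffRoadExplicit.endpointExistence_of_residualChainδ`
# and of `exists_remainderMod_of_residualChainδ_carrierBal` is inhabited SIMULTANEOUSLY by closed terms over co-owner #3's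
# constructed carrier `carrierFamily`, and both conclusions are obtained BY NAME (unit `b2b-balaban-beta-d4-p2`, gen 3)

HONEST FRAMING (page 1 of everything the β sub-cell writes): discharging `BetaPertH` makes Bałaban's UV stability
UNCONDITIONAL — a real constructive-QFT result; it is NOT the continuum limit and NOT the Clay problem.  HONEST DEPENDENCY
(cell reorg 2026-08-19, verbatim): «continuum YM on T⁴ ⇐ BetaPertH ∧ nine spine estimates (0/9 proved); BetaPertH ⇐ (D1) ∧
(D4) ∧ CAP+tail; G-an2-4 gates asym, D1 and NE2/3/4.»  THIS MODULE DISCHARGES NOTHING of `BetaPertH` and asserts NOTHING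
about Bałaban's densities: it is a kernel CERTIFICATE OF CONSISTENCY — the twin, for the δ-chain of `VariantCutoffRoadExplicit`,
of co-owner #3's `RemainderExplicitEndWitness.end_inhabited_and_applied` (road P3) and of this unit's
`VariantCutoffRoadWitness.wallEndδ_applied` (road P2″): the zero-activity torus steps of the row owner
(`RemainderWitness.zeroStep`, via co-owner #3's `zeroResidualBal`) placed over the CONSTRUCTED carrier `carrierBal` AT THE
SUBSTITUTED RECORDS `withEps c (δ(g_k))`, the witness constants `cδ δ₀⋆` (rate chosen at the carrier's), a box `]0,γ₁]`
from `exists_gamma_hyps`, the constant split `β ≡ λ`, and the lead's `modelOf`.  Were the binders jointly unsatisfiable the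
ENDs would be vacuous; they are not.  Nothing of the analytic CONTENT of any field is tested (zero activities).  Nothing is
cited as a fact (ABSOLUTE RULE).
-/

namespace Summit.QuantumFields.BalabanUV.Beta.VariantCutoffRoadExplicitWitness

open Literature.MathematicalPhysics.QuantumFieldTheory.Balaban1983to89
open Literature.MathematicalPhysics.QuantumFieldTheory.Balaban1983to89.Beta
open FlowStep FlowStepRuns DagBinding
open Literature.MathematicalPhysics.QuantumFieldTheory.Balaban1983to89.Beta.RemainderChainLattice (CondsL remCoeffL)
open Literature.MathematicalPhysics.QuantumFieldTheory.Balaban1983to89.Beta.RemainderLimitTorus (LDom)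
open Literature.MathematicalPhysics.QuantumFieldTheory.Balaban1983to89.Beta.Drift (OneLoopDrift)
open Literature.MathematicalPhysics.QuantumFieldTheory.Balaban1983to89.Beta.RemainderWitness (splitConst)
open Summit.QuantumFields.BalabanUV.Beta.RoadP2Chain (RemainderMod)
open Summit.QuantumFields.BalabanUV.Beta.VariantCutoffRoad
open Summit.QuantumFields.BalabanUV.Beta.VariantCutoffRoadColumns (exists_gamma_hyps)
open Summit.QuantumFields.BalabanUV.Beta.VariantCutoffRoadWitness (drift_const)
open Summit.QuantumFields.BalabanUV.Beta.VariantCutoffRoadExplicit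
open Summit.QuantumFields.BalabanUV.Beta.RemainderExplicitRoad
open Summit.QuantumFields.BalabanUV.Beta.RemainderExplicitCarrier (carrierBal exists_decay_carrierBal limit_carrierBal)
open Summit.QuantumFields.BalabanUV.Beta.RemainderExplicitEnd (carrierFamily)
open Summit.QuantumFields.BalabanUV.Beta.RemainderExplicitEndWitness (cδ cδ_condsL cδ_R22gen cδ_δ₀ zeroResidualBal)
open Metric Filter Topology Set

noncomputable section

section Carrier

variable (Lc : ℕ) [NeZero Lc] (Mc : ℕ) [NeZero Mc] (Nn : ℕ → ℕ) [∀ n, NeZero (Nn n)]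

/-! ## §1 The witness constants: co-owner #3's `cδ δ` (the owner's `c₀ 4` with rate `δ`) meet road P2″'s ε₁-free conditions -/

/-- [folklore] The three ε₁-free conditions `CondsL0` hold for `cδ δ` at ℓ = 2 (they read `κ, δ, A₂` only). -/
theorem cδ_condsL0 (δ : ℝ) : CondsL0 4 (cδ δ) 2 := CondsL0.of_condsL (cδ_condsL δ)

/-- [folklore] `C₃(cδ δ) ≥ 0` (the activity constant does not read the rate δ₀; it is the owner's `C₃(c₀ 4) = 162`). -/
theorem cδ_C3act_nonneg (δ : ℝ) : 0 ≤ (cδ δ).C3act :=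
  VariantCutoffRoadWitness.c₀_C3act_nonneg 4

/-! ## §2 The zero δ-chain RELATIVE TO THE EXPLICIT CARRIER FAMILY -/

/-- **THE ZERO δ-CHAIN OVER `carrierFamily`** for the constant split `β ≡ β⁰ ≡ λ`, `β¹ ≡ 0` on a box `]0,γ]`, `γ ≤ 1`:
zero infinite-volume terms, and at each scale/history co-owner #3's zero residual `zeroResidualBal` over the CONSTRUCTED
carrier, taken AT THE SUBSTITUTED RECORD `withEps c (δ(g_k))` (its sign hypothesis `0 ≤ C₃·δ(g_k)` from `C₃ ≥ 0`, `A₁ ≥ 0`,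
`0 < g_k ≤ γ ≤ 1`). [folklore] -/
def zeroResidualChainδBal (hN : Tendsto Nn atTop atTop) (μ ν : Fin 4) (lam γ : ℝ) (c : B13.Consts) (ℓ α₂ A₁ : ℝ)
    (p₀ : ℕ) (hγ1 : γ ≤ 1) (hC3 : 0 ≤ c.C3act) (hA₁ : 0 ≤ A₁) :
    ResidualChainδ 4 Mc μ ν (splitConst lam) γ c ℓ α₂ A₁ p₀ (carrierFamily Lc Mc Nn hN μ ν) where
  A1 := fun _ _ _ _ => 0
  beta1_eq := fun _ _ _ => by
    show (0 : ℝ) = B12Beta.secondMoment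
      (fun _ _ => RemainderLimitTorus.limKernel (fun (_ : LDom 4) (_ : B13ScaleTransfer.Pt 4) => (0 : ℝ))) μ ν
    simp [B12Beta.secondMoment, RemainderLimitTorus.limKernel]
  res := fun k p hp => zeroResidualBal Lc Mc Nn k hN μ ν (withEps c (deltaOf A₁ p₀ (p (Fin.last k)))) ℓ α₂ (by
    rw [C3act_withEps, withEps_eps1]
    exact mul_nonneg hC3 (deltaOf_nonneg hA₁ p₀ (hp (Fin.last k)).1 ((hp (Fin.last k)).2.trans hγ1)))

/-! ## §3 Every hypothesis inhabited simultaneously, and both conclusions obtained BY NAME -/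

/-- [folklore] **THE HYPOTHESES OF `exists_remainderMod_of_residualChainδ_carrierBal` ARE JOINTLY INHABITED, AND IT FIRES**:
with that theorem's own constants `(δ₀⋆, B₃)` there are a box `]0,γ₁]` (`γ₁ ≤ 1`), constants `c := cδ δ₀⋆` (rate AT the
carrier's), `ℓ = 2`, `α₂ = 1`, `A₁ = 1`, a δ-chain RELATIVE TO THE EXPLICIT CARRIER FAMILY, and `Hyps 4 γ₁ c 2 1 p₀` — and the
ω-form `RemainderMod (splitConst λ) γ₁ (δ(·)·K_rem,L)` follows (any λ > 0, any p₀). -/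
theorem remainderMod_inhabited_and_applied (hN : Tendsto Nn atTop atTop) (μ ν : Fin 4) {lam : ℝ} (hlam : 0 < lam)
    (p₀ : ℕ) :
    ∃ δ₀ B₃ γ₁ : ℝ, 0 < δ₀ ∧ 0 ≤ B₃ ∧ 0 < γ₁ ∧ γ₁ ≤ 1 ∧
      Nonempty (ResidualChainδ 4 Mc μ ν (splitConst lam) γ₁ (cδ δ₀) 2 1 1 p₀ (carrierFamily Lc Mc Nn hN μ ν)) ∧
      Hyps 4 γ₁ (cδ δ₀) 2 1 p₀ ∧ 0 < (cδ δ₀).δ₀ ∧ (cδ δ₀).δ₀ ≤ δ₀ ∧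
      RemainderMod (splitConst lam) γ₁ (fun g => deltaOf 1 p₀ g * remCoeffL 4 Mc (cδ δ₀) 1 B₃) := by
  obtain ⟨δ₀, B₃, hδ, hB, hEND⟩ := exists_remainderMod_of_residualChainδ_carrierBal Lc Mc Nn hN μ ν
  obtain ⟨γ₁, hγ₁, hγ₁1, H, _⟩ :=
    exists_gamma_hyps (p₀ := p₀) (cδ_condsL0 δ₀) (cδ_R22gen δ₀) (cδ_C3act_nonneg δ₀) zero_le_one Mc 1 B₃ hlam one_pos
  have hδpos : 0 < (cδ δ₀).δ₀ := by rw [cδ_δ₀]; exact hδ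
  have hδle : (cδ δ₀).δ₀ ≤ δ₀ := by rw [cδ_δ₀]
  refine ⟨δ₀, B₃, γ₁, hδ, hB, hγ₁, hγ₁1,
    ⟨zeroResidualChainδBal Lc Mc Nn hN μ ν lam γ₁ (cδ δ₀) 2 1 1 p₀ hγ₁1 (cδ_C3act_nonneg δ₀) zero_le_one⟩, H, hδpos,
    hδle, ?_⟩
  exact hEND (zeroResidualChainδBal Lc Mc Nn hN μ ν lam γ₁ (cδ δ₀) 2 1 1 p₀ hγ₁1 (cδ_C3act_nonneg δ₀) zero_le_one) H
    one_pos hδpos hδle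

end Carrier

/-- [folklore] **THE P3 ⊕ P2″ WALL END, APPLIED OVER THE EXPLICIT CARRIER FAMILY**: `endpointExistence_of_residualChainδ`
with EVERY argument a closed term — the zero δ-chain over `carrierFamily`, (E) and (V) of the CONSTRUCTED carrier BY NAME
(`exists_decay_carrierBal`, `limit_carrierBal`), `Hyps` from `exists_gamma_hyps`, the drift of the constant family
(b := λ, A := 0), continuity, forward generation of `modelOf (β ≡ λ)` — conclusion `EndpointExistence (modelOf (β ≡ λ))` for
every λ > 0 (any `Lc, Mc ≥ 1`, exhausting `Nn`, μ, ν, p₀).  Zero content about Bałaban's flow; the content is that the END's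
ARGUMENTS exist together relative to the explicit carrier. -/
theorem wallEndδ_applied_carrierBal (Lc : ℕ) [NeZero Lc] (Mc : ℕ) [NeZero Mc] (Nn : ℕ → ℕ) [∀ n, NeZero (Nn n)]
    (hN : Tendsto Nn atTop atTop) (μ ν : Fin 4) {lam : ℝ} (hlam : 0 < lam) (p₀ : ℕ) :
    EndpointExistence (modelOf fun _ _ => lam) := by
  obtain ⟨δ₀, B₃, hδ, hB, hdec⟩ := exists_decay_carrierBal Lc Mc μ ν
  obtain ⟨γ₁, hγ₁, hγ₁1, H, _⟩ :=
    exists_gamma_hyps (p₀ := p₀) (cδ_condsL0 δ₀) (cδ_R22gen δ₀) (cδ_C3act_nonneg δ₀) zero_le_one Mc 1 B₃ hlam one_pos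
  have hδpos : 0 < (cδ δ₀).δ₀ := by rw [cδ_δ₀]; exact hδ
  have hE : ∀ k, (carrierFamily Lc Mc Nn hN μ ν k).Decay B₃ (cδ δ₀).δ₀ :=
    fun k => (hdec k Nn hN).mono _ le_rfl hB (by rw [cδ_δ₀]) hδpos.le
  have hV : ∀ k, (carrierFamily Lc Mc Nn hN μ ν k).Limit := fun k => limit_carrierBal Lc k Mc Nn hN μ ν
  exact endpointExistence_of_residualChainδ (modelOf_forwardGenerated _) (splitConst lam)
    (zeroResidualChainδBal Lc Mc Nn hN μ ν lam γ₁ (cδ δ₀) 2 1 1 p₀ hγ₁1 (cδ_C3act_nonneg δ₀) zero_le_one) H hE hV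
    one_pos hB hδpos (by norm_num) hγ₁ hlam (drift_const lam) fun _ => continuousOn_const

/-- Lc = 2, Mc = 3, the tori `N_n = n + 1`, λ = 1, p₀ = 23: the P3 ⊕ P2″ END applies at the physical dimension over the
explicit carrier family. -/
example : EndpointExistence (modelOf fun _ _ => (1 : ℝ)) :=
  wallEndδ_applied_carrierBal 2 3 (fun n => n + 1) (tendsto_add_atTop_nat 1) 0 1 one_pos 23

end

end Summit.QuantumFields.BalabanUV.Beta.VariantCutoffRoadExplicitWitness
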